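import Summits.HodgeConjecture.HodgeConjecture.Theses.BoundaryReadout
import Literature.AlgebraicGeometry.Morphisms.SmoothOfFlatFibre
import Literature.AlgebraicGeometry.Motives.FlatOverSmoothCurve
import Literature.AlgebraicGeometry.Motives.AbelianVarietyProofs
import Literature.AlgebraicGeometry.Motives.UniversalHyperplaneSectionFamily
import Literature.AlgebraicGeometry.Motives.VarietiesGeometricallyIntegralProofs
import Literature.AlgebraicGeometry.Motives.VarietiesProperProofs
import Mathlib.AlgebraicGeometry.Limits
import HarnessLib

/-!
# Route `BoundaryReadout` — crux `BoundaryAbsoluteness` (stmt-HodgeConjecture-15913), line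
# `typewise_readout`, stub `stub_smoothFibreLocus`: the smooth-fibre locus of a family over a curve

Helper file for the crux item stmt-HodgeConjecture-15913 (`--supports`; it closes nothing): it proves
the registered stub `stub_smoothFibreLocus` (STATEMENT 5B, the scheme theory of the fibre kernel
inclusion) of the skeleton `Cruxes/BoundaryAbsoluteness/Lines/typewise_readout.lean`, verbatim:

> for `f : 𝒳 ⟶ C` surjective from a smooth projective variety (dimension `N`) onto a smooth
> projective curve over `ℂ` there is an open `W ⊆ C` over which `f` is smooth of ONE relative
> dimension `d`, containing the underlying point `t.pt` of every `ℂ`-point `t` of `C` whose fibre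
> `X_t = fiberOver f t` is smooth projective.

## Proof

* `f` (i.e. `f.left : 𝒳 → C`) is proper (`𝒳 → Spec ℂ` proper, `C → Spec ℂ` separated; Hartshorne
  II Cor. 4.8 (e)), locally of finite presentation (finite type over the Noetherian `C`), and FLAT:
  `𝒳` is integral, `C` is an integral curve smooth over `ℂ`, and `f` is surjective, hence dominant
  (Hartshorne III Prop. 9.7, the tree's `Motives.flat_of_isDominant_of_smoothCurve`).
* `W := C ∖ f(𝒳 ∖ sm(𝒳/C))` (`sm` = Mathlib's open smooth locus `Scheme.Hom.smoothLocus`) is open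
  because `f` is closed, `f⁻¹(W) ⊆ sm(𝒳/C)`, so `f⁻¹(W) → W` is smooth
  (`Morphisms.smooth_morphismRestrict_of_preimage_le_smoothLocus`).
* ONE relative dimension: if `f⁻¹(W) = ∅` the restriction is an open immersion, smooth of relative
  dimension `0`; otherwise `f⁻¹(W)` is a non-empty open of the integral `𝒳`, hence irreducible, and
  a smooth morphism with irreducible source is smooth of some fixed relative dimension
  (`Motives.exists_smoothOfRelativeDimension_of_smooth`).
* Membership: if `X_t` is smooth projective of dimension `n`, Mathlib's scheme-theoretic fibre
  `f⁻¹(t.pt) → Spec κ(t.pt)` is smooth (`t` is `ℂ`-rational and `C` is separated: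
  `Motives.SectionFamily.smooth_fiberToSpecResidueField_of_fiberOver`), and `f` is flat at every
  point `x` over `t.pt`, so `x ∈ sm(𝒳/C)` (EGA IV₄ 17.5.1,
  `Morphisms.mem_smoothLocus_of_flat_stalkMap_of_smooth_fiber`); hence `t.pt ∉ f(𝒳 ∖ sm(𝒳/C))`.

No named fact is used; all ingredients are PROVED tree theorems or Mathlib.

## Main result

* `stub_smoothFibreLocus` — the registered stub (name and signature verbatim), PROVED.

## References

* A. Grothendieck, EGA IV₄ (1967), Thm. 17.5.1 (flat with smooth fibre ⇒ smooth). [EGAIV4]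
* R. Hartshorne, *Algebraic Geometry* (1977), III Prop. 9.7 (integral schemes dominating a regular
  curve are flat), III Thm. 10.2, II Cor. 4.8 (e). [Hartshorne1977]
* H. Matsumura, *Commutative Ring Theory* (1986), Thm. 23.1. [Matsumura1987]
-/

-- every declaration of this problem lives in `Summit.HodgeConjecture.HodgeConjecture.…`
-- (single-problem summit: Problem = Summit), which `linter.dupNamespace` flags; set so that
-- stand-alone elaboration is warning-free.
set_option linter.dupNamespace false

noncomputable section

namespace Summit.HodgeConjecture.HodgeConjecture.Theorems

open CategoryTheory AlgebraicGeometry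
open Literature.AlgebraicGeometry.Motives Literature.AlgebraicGeometry.HodgeTheory

namespace BoundaryAbsolutenessSmoothFibreLocus

variable {N : ℕ} {𝒳 C : SchemeOver ℂ} (f : 𝒳 ⟶ C)

/-- A morphism `f : 𝒳 ⟶ C` of `ℂ`-schemes from a smooth projective variety to a smooth projective
curve is locally of finite presentation (locally of finite type, as the first factor of the
smooth `𝒳 → Spec ℂ`, over the locally Noetherian `C`). [folklore] -/
theorem locallyOfFinitePresentation_left (h𝒳 : IsSmoothProjective N 𝒳)
    (hC : IsSmoothProjective 1 C) : LocallyOfFinitePresentation f.left := by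
  haveI : LocallyOfFiniteType (f.left ≫ C.hom) := by
    rw [Over.w f]
    haveI := h𝒳.smoothOfRelativeDimension
    haveI : Smooth 𝒳.hom := SmoothOfRelativeDimension.smooth N 𝒳.hom
    infer_instance
  haveI : LocallyOfFiniteType f.left := locallyOfFiniteType_of_comp f.left C.hom
  haveI : IsLocallyNoetherian C.left := IsSmoothProjective.isLocallyNoetherian_holds hC
  infer_instance

/-- **A surjection from a smooth projective variety onto a smooth projective curve is flat**:
the source is integral, the target is an integral curve smooth over `ℂ`, and a surjective
morphism is dominant (Hartshorne III Prop. 9.7, tree `flat_of_isDominant_of_smoothCurve`).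
[cite: Hartshorne1977, III Prop. 9.7] -/
theorem flat_left (h𝒳 : IsSmoothProjective N 𝒳) (hC : IsSmoothProjective 1 C)
    (hf : Function.Surjective f.left.base) : Flat f.left := by
  haveI : IsIntegral 𝒳.left := IsSmoothProjective.isIntegral_holds h𝒳
  haveI : IsIntegral C.left := IsSmoothProjective.isIntegral_holds hC
  haveI := hC.smoothOfRelativeDimension
  haveI : IsDominant f.left := ⟨hf.denseRange⟩
  exact flat_of_isDominant_of_smoothCurve C f.left

/-- **Every point over a `ℂ`-point with smooth projective fibre is a smooth point of `f`**
(EGA IV₄ 17.5.1): for `f` flat and locally of finite presentation over a separated `C`, if the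
fibre `X_t = fiberOver f t` over `t ∈ C(ℂ)` is smooth projective then the scheme-theoretic fibre
`f⁻¹(t.pt) → Spec κ(t.pt)` is smooth (`t` is rational), and flat + smooth fibre at `x` puts `x` in
the smooth locus. [cite: EGAIV4, Thm. 17.5.1] -/
theorem mem_smoothLocus_of_isSmoothProjective_fiberOver [LocallyOfFinitePresentation f.left]
    [Flat f.left] [IsSeparated C.hom] (t : AlgPoints C ℂ) {n : ℕ}
    (ht : IsSmoothProjective n (fiberOver f t)) {x : 𝒳.left} (hx : f.left.base x = t.pt) :
    x ∈ f.left.smoothLocus := by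
  have hsm : Smooth (f.left.fiberToSpecResidueField (f.left.base x)) := by
    rw [hx]
    exact (SectionFamily.smooth_fiberToSpecResidueField_of_fiberOver f t
      ht.smoothOfRelativeDimension).1
  exact Literature.AlgebraicGeometry.Morphisms.mem_smoothLocus_of_flat_stalkMap_of_smooth_fiber
    f.left (Flat.stalkMap f.left x) hsm

end BoundaryAbsolutenessSmoothFibreLocus

open BoundaryAbsolutenessSmoothFibreLocus

/-- **STUB 5B of the line `typewise_readout` (crux `BoundaryAbsoluteness`) — the smooth-fibre
locus.** For `f : 𝒳 ⟶ C` surjective from a smooth projective variety onto a smooth projective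
curve over `ℂ` there is an open `W ⊆ C` with `f⁻¹(W) → W` smooth of one relative dimension `d`
such that `t.pt ∈ W` for every `ℂ`-point `t` of `C` whose fibre `fiberOver f t` is smooth
projective. `W = C ∖ f(𝒳 ∖ sm(𝒳/C))`: `f` is proper (closed) and flat (Hartshorne III.9.7), so a
smooth fibre consists of smooth points of `f` (EGA IV₄ 17.5.1); the relative dimension is constant
on the irreducible `f⁻¹(W)` (or `f⁻¹(W) = ∅` and `d = 0`).
[cite: EGAIV4, Thm. 17.5.1] [cite: Hartshorne1977, III Prop. 9.7] [cite: Matsumura1987, Thm. 23.1] -/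
theorem stub_smoothFibreLocus :
    ∀ ⦃N : ℕ⦄ ⦃𝒳 C : SchemeOver ℂ⦄ (f : 𝒳 ⟶ C), IsSmoothProjective N 𝒳 → IsSmoothProjective 1 C →
      Function.Surjective f.left.base →
      ∃ (W : C.left.Opens) (d : ℕ), SmoothOfRelativeDimension d (f.left ∣_ W) ∧
        ∀ (t : AlgPoints C ℂ) ⦃n : ℕ⦄, IsSmoothProjective n (fiberOver f t) → t.pt ∈ W := by
  intro N 𝒳 C f h𝒳 hC hf
  haveI : IsProper C.hom := IsSmoothProjective.isProper_holds hC
  -- `f` is proper (`f ≫ (C → Spec ℂ) = (𝒳 → Spec ℂ)` proper, `C → Spec ℂ` separated; this is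
  -- `BoundaryAbsolutenessVanishingPropagation.isProper_left` of the sibling stub file, inlined)
  haveI : IsProper f.left := by
    haveI : IsProper (f.left ≫ C.hom) := by
      rw [Over.w f]
      exact IsSmoothProjective.isProper_holds h𝒳
    exact IsProper.of_comp f.left C.hom
  haveI : LocallyOfFinitePresentation f.left := locallyOfFinitePresentation_left f h𝒳 hC
  haveI : Flat f.left := flat_left f h𝒳 hC hf
  haveI : IsIntegral 𝒳.left := IsSmoothProjective.isIntegral_holds h𝒳
  -- `W := C ∖ f(𝒳 ∖ sm(𝒳/C))`, open since `f` is closed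
  have hcl : IsClosed (f.left.base '' (f.left.smoothLocus : Set 𝒳.left)ᶜ) :=
    f.left.isClosedMap _ f.left.smoothLocus.isOpen.isClosed_compl
  let W : C.left.Opens := ⟨(f.left.base '' (f.left.smoothLocus : Set 𝒳.left)ᶜ)ᶜ, hcl.isOpen_compl⟩
  have hmemW : ∀ y : C.left, (∀ x : 𝒳.left, f.left.base x = y → x ∈ f.left.smoothLocus) → y ∈ W := by
    intro y h
    rintro ⟨x, hx, hxy⟩
    exact hx (h x hxy)
  -- `f⁻¹(W) ⊆ sm(𝒳/C)`, so `f⁻¹(W) → W` is smooth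
  have hW : f.left ⁻¹ᵁ W ≤ f.left.smoothLocus := fun x hx => by
    by_contra hxs
    exact hx ⟨x, hxs, rfl⟩
  haveI hsmW : Smooth (f.left ∣_ W) :=
    Literature.AlgebraicGeometry.Morphisms.smooth_morphismRestrict_of_preimage_le_smoothLocus
      f.left W hW
  -- one relative dimension: `f⁻¹(W)` is empty or irreducible
  obtain ⟨d, hd⟩ : ∃ d : ℕ, SmoothOfRelativeDimension d (f.left ∣_ W) := by
    rcases isEmpty_or_nonempty ((f.left ⁻¹ᵁ W : 𝒳.left.Opens) : Scheme.{0}) with h | h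
    · exact ⟨0, inferInstance⟩
    · haveI : IsIntegral ((f.left ⁻¹ᵁ W : 𝒳.left.Opens) : Scheme.{0}) :=
        isIntegral_of_isOpenImmersion (f.left ⁻¹ᵁ W).ι
      exact exists_smoothOfRelativeDimension_of_smooth (f.left ∣_ W)
  refine ⟨W, d, hd, fun t n ht => hmemW t.pt fun x hx => ?_⟩
  exact mem_smoothLocus_of_isSmoothProjective_fiberOver f t ht hx

end Summit.HodgeConjecture.HodgeConjecture.Theorems

end
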